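import Summits.ABC.ABC.Theses.RibetTakahashiSplit
import Literature.NumberTheory.EllipticCurves.SzpiroLocalDataProofs

/-!
# Crux `RibetTakahashiSplit.ThinWeightedSzpiro` (stmt-ABC-17927), line `Sketch`: stub `stub_transfer`

Helper (`--supports stmt-ABC-17927`) for the line `Sketch` (idea `thin-strong-hall-transfer`) of the
crux r3″ `Summit.ABC.ABC.Theses.RibetTakahashiSplit.ThinWeightedSzpiro` (thin-class weighted Szpiro
with a frozen class exponent): the registered stub `stub_transfer`, the TRANSFER step of the
composition `ThinWeightedSzpiro_of := stub_transfer stub_localData stub_weights (…)`.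

What it says.  Write `x = c₄(W₀)`, `y = c₆(W₀)`, `z = x³ − y² = 1728·Δ(W₀)`
(`WeierstrassCurve.c_relation`), `R := ∏_{p ≥ 5, p ∣ z} p`, `V := ∏_{p ≥ 5, p ∣ z} v_p(z)`,
`N := N(W₀ ⊗ ℚ)` (conductor), `T := ∏_{p ∥ N} ord_p(Δ_min)`.  Assume
1. (local data, `= stub_localData`) for every global minimal model `W₀` semistable away from `2`:
   `z ≠ 0`, `1728 ∣ z`, primitivity at `2` and `3`, and `p ≥ 5, p ∣ x ⇒ p ∤ z`;
2. (weights, `= stub_weights`) for the same `W₀`: `R ∣ N`, `N ∣ 768·R`, `V ≤ T`;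
3. (the ℕ normal form `ThinStrongHall`, unfolded) `∃ θ > 0 ∀ ε > 0 ∀ K ∃ C`, for all integers
   `x, y` with the side conditions of 1.: `V ≤ K·R^θ ⇒ max(|z|, |x|³) ≤ C (R·V)^{6+ε}`.
Then the crux: `∃ θ > 0 ∀ ε > 0 ∀ K ∃ C`, for every such `W₀`,
`T ≤ K·N^θ ⇒ max(|Δ(W₀)|, |c₄(W₀)|³) ≤ C (N·T)^{6+ε}`.

Proof sketch (pure real-inequality assembly, no elliptic-curve theory beyond `c_relation` and
`N > 0` = `WeierstrassCurve.conductorNorm_pos_holds`).  Take the same `θ`; given `ε, K` apply 3. with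
the constant `K' := max K 0 · 768^θ` to get `C`, and answer with `max C 0`.  For `W₀` as in the
crux: `N ≤ 768 R` (from `N ∣ 768 R`, `R > 0`) and `V ≤ T ≤ K N^θ ≤ K (768 R)^θ = K' R^θ`
(if `K < 0` the thinness hypothesis is vacuous since `T ≥ 0`), so 3. applies to `(c₄, c₆)`:
`max(|z|, |c₄|³) ≤ C (R V)^{6+ε}`; finally `|Δ| ≤ 1728 |Δ| = |z|` and `R V ≤ N T`
(`R ≤ N` from `R ∣ N`, `N > 0`; `V ≤ T`), and `t ↦ t^{6+ε}` is monotone.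

Contents: three private real/integer bookkeeping lemmas and `stub_transfer` (the registered
signature, verbatim).  Deliberately NOT here: the §0 vocabulary (`rad5`, `wt5`, `Prim23`,
`ThinStrongHall`) of the line — the products are written out so that this file lands independently
of the Defs review — and the other stubs (`stub_localData`, `stub_weights`, `stub_cusp`, `stub_bulk`).
-/

-- `Summit.<Summit>.<Problem>` is the mandated summit-side namespace (CONVENTIONS §2); for the
-- single-conjunct summit `ABC` the two coincide, so the duplicate `ABC.ABC` is deliberate.
set_option linter.dupNamespace false

namespace Summit.ABC.ABC.Theorems.ThinWeightedSzpiro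

open Summit.ABC.ABC.Theses.RibetTakahashiSplit

/-! ## Real-inequality bookkeeping -/

/-- A product of natural numbers `≥ 5` over a filtered finset is positive (so `R = ∏_{p ≥ 5, p ∣ z} p > 0`).
`[folklore]` -/
private theorem stubTransfer_prod_filter_five_le_pos (s : Finset ℕ) :
    0 < ∏ p ∈ s with 5 ≤ p, p :=
  Finset.prod_pos fun p hp => lt_of_lt_of_le (by norm_num) (Finset.mem_filter.mp hp).2

/-- Thinness transfer: if `0 < N ≤ 768 R`, `V ≤ T` and `T ≤ K N^θ` (`θ > 0`), then
`V ≤ (max K 0 · 768^θ) · R^θ`.  For `K ≥ 0` this is `V ≤ T ≤ K N^θ ≤ K (768 R)^θ`; for `K < 0` the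
hypothesis `0 ≤ T ≤ K N^θ < 0` is contradictory. `[folklore]` -/
private theorem stubTransfer_thin_aux {R V N T : ℕ} {K θ : ℝ} (hθ : 0 < θ) (hNpos : 0 < N)
    (hNle : N ≤ 768 * R) (hVT : V ≤ T) (hthin : (T : ℝ) ≤ K * (N : ℝ) ^ θ) :
    (V : ℝ) ≤ max K 0 * (768 : ℝ) ^ θ * (R : ℝ) ^ θ := by
  have hV : (V : ℝ) ≤ T := by exact_mod_cast hVT
  have hN : (0 : ℝ) < N := by exact_mod_cast hNpos
  have hNθ : (0 : ℝ) < (N : ℝ) ^ θ := Real.rpow_pos_of_pos hN θ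
  by_cases hK : 0 ≤ K
  · have hNle' : (N : ℝ) ≤ 768 * R := by exact_mod_cast hNle
    have h1 : (N : ℝ) ^ θ ≤ ((768 : ℝ) * R) ^ θ := Real.rpow_le_rpow hN.le hNle' hθ.le
    rw [max_eq_left hK, mul_assoc, ← Real.mul_rpow (by norm_num) (Nat.cast_nonneg R)]
    exact hV.trans (hthin.trans (mul_le_mul_of_nonneg_left h1 hK))
  · exfalso
    have hneg : K * (N : ℝ) ^ θ < 0 := mul_neg_of_neg_of_pos (not_le.mp hK) hNθ
    have hT0 : (0 : ℝ) ≤ T := Nat.cast_nonneg T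
    linarith

/-- The final chain: from `H ≤ H' ≤ C (R V)^{6+ε}`, `R ≤ N`, `V ≤ T` (naturals) and `ε > 0`,
`H ≤ max C 0 · (N T)^{6+ε}` (monotonicity of `t ↦ t^{6+ε}` on `t ≥ 0`). `[folklore]` -/
private theorem stubTransfer_chain_aux {R V N T : ℕ} {C ε H H' : ℝ} (hε : 0 < ε)
    (key : H' ≤ C * ((R : ℝ) * (V : ℝ)) ^ (6 + ε)) (hHH' : H ≤ H') (hRN : R ≤ N) (hVT : V ≤ T) :
    H ≤ max C 0 * ((N : ℝ) * (T : ℝ)) ^ (6 + ε) := by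
  have hRV0 : (0 : ℝ) ≤ (R : ℝ) * (V : ℝ) := by positivity
  have hRVNT : (R : ℝ) * (V : ℝ) ≤ (N : ℝ) * (T : ℝ) :=
    mul_le_mul (by exact_mod_cast hRN) (by exact_mod_cast hVT) (Nat.cast_nonneg V)
      (Nat.cast_nonneg N)
  have hexp : (0 : ℝ) ≤ 6 + ε := by linarith
  have hpow : ((R : ℝ) * (V : ℝ)) ^ (6 + ε) ≤ ((N : ℝ) * (T : ℝ)) ^ (6 + ε) :=
    Real.rpow_le_rpow hRV0 hRVNT hexp
  have hpow0 : (0 : ℝ) ≤ ((R : ℝ) * (V : ℝ)) ^ (6 + ε) := Real.rpow_nonneg hRV0 _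
  calc H ≤ H' := hHH'
    _ ≤ C * ((R : ℝ) * (V : ℝ)) ^ (6 + ε) := key
    _ ≤ max C 0 * ((R : ℝ) * (V : ℝ)) ^ (6 + ε) :=
        mul_le_mul_of_nonneg_right (le_max_left _ _) hpow0
    _ ≤ max C 0 * ((N : ℝ) * (T : ℝ)) ^ (6 + ε) :=
        mul_le_mul_of_nonneg_left hpow (le_max_right _ _)

/-- `max(|Δ|, |c₄|³) ≤ max(|c₄³ − c₆²|, |c₄|³)` for an integral Weierstrass equation, since
`c₄³ − c₆² = 1728 Δ` (`WeierstrassCurve.c_relation`) and `|Δ| ≤ 1728 |Δ|`. `[folklore]` -/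
private theorem stubTransfer_max_abs_le_aux (W₀ : WeierstrassCurve ℤ) :
    (max |W₀.Δ| (|W₀.c₄| ^ 3) : ℤ) ≤ max |W₀.c₄ ^ 3 - W₀.c₆ ^ 2| (|W₀.c₄| ^ 3) := by
  rw [← W₀.c_relation, abs_mul, abs_of_pos (by norm_num : (0 : ℤ) < 1728)]
  exact max_le_max (le_mul_of_one_le_left (abs_nonneg _) (by norm_num)) le_rfl

/-! ## The registered stub -/

/-- **Stub `stub_transfer` (line `Sketch` of crux r3″ `ThinWeightedSzpiro`).**  Local data of global
minimal models semistable away from `2` read on `(c₄, c₆, c₄³ − c₆² = 1728Δ)` (hypothesis 1), the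
conductor bookkeeping `∏_{p ≥ 5, p ∣ 1728Δ} p ∣ N ∣ 768 · ∏_{p ≥ 5, p ∣ 1728Δ} p`,
`∏_{p ≥ 5} v_p(1728Δ) ≤ T` (hypothesis 2) and the ℕ normal form `ThinStrongHall` of the line,
unfolded (hypothesis 3: weighted thin strong Hall for `x³ − y²`), imply the crux
`RibetTakahashiSplit.ThinWeightedSzpiro` with the SAME class exponent `θ`: given `ε, K`, apply the
normal form with `K' = max K 0 · 768^θ` and take `max C 0`; then `V ≤ T ≤ K N^θ ≤ K' R^θ`
(`N ≤ 768 R`), `max(|Δ|, |c₄|³) ≤ max(|1728Δ|, |c₄|³) ≤ C (R V)^{6+ε} ≤ max C 0 · (N T)^{6+ε}`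
(`R ≤ N`, `V ≤ T`, `N > 0` by `WeierstrassCurve.conductorNorm_pos_holds`). `[folklore]` -/
theorem stub_transfer :
    (∀ W₀ : WeierstrassCurve ℤ, (W₀.baseChange ℚ).IsElliptic →
      (∀ v : IsDedekindDomain.HeightOneSpectrum ℤ, (W₀.baseChange ℚ).IsMinimalAt v) →
      (∀ p : ℕ, p.Prime → p ≠ 2 → ¬ p ^ 2 ∣ (W₀.baseChange ℚ).conductorNorm ℤ) →
      W₀.c₄ ^ 3 - W₀.c₆ ^ 2 ≠ 0 ∧ (1728 : ℤ) ∣ W₀.c₄ ^ 3 - W₀.c₆ ^ 2 ∧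
      (¬ ((2 : ℤ) ^ 8 ∣ W₀.c₄ ∧ (2 : ℤ) ^ 11 ∣ W₀.c₆ ∧ (2 : ℤ) ^ 12 * 1728 ∣ W₀.c₄ ^ 3 - W₀.c₆ ^ 2) ∧
        ¬ ((3 : ℤ) ^ 4 ∣ W₀.c₄ ∧ (3 : ℤ) ^ 9 ∣ W₀.c₆ ∧ (3 : ℤ) ^ 12 * 1728 ∣ W₀.c₄ ^ 3 - W₀.c₆ ^ 2)) ∧
      (∀ p : ℕ, p.Prime → 5 ≤ p → (p : ℤ) ∣ W₀.c₄ → ¬ (p : ℤ) ∣ W₀.c₄ ^ 3 - W₀.c₆ ^ 2)) →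
    (∀ W₀ : WeierstrassCurve ℤ, (W₀.baseChange ℚ).IsElliptic →
      (∀ v : IsDedekindDomain.HeightOneSpectrum ℤ, (W₀.baseChange ℚ).IsMinimalAt v) →
      (∀ p : ℕ, p.Prime → p ≠ 2 → ¬ p ^ 2 ∣ (W₀.baseChange ℚ).conductorNorm ℤ) →
      (∏ p ∈ (W₀.c₄ ^ 3 - W₀.c₆ ^ 2).natAbs.primeFactors with 5 ≤ p, p) ∣
          (W₀.baseChange ℚ).conductorNorm ℤ ∧
      (W₀.baseChange ℚ).conductorNorm ℤ ∣
          768 * ∏ p ∈ (W₀.c₄ ^ 3 - W₀.c₆ ^ 2).natAbs.primeFactors with 5 ≤ p, p ∧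
      (∏ p ∈ (W₀.c₄ ^ 3 - W₀.c₆ ^ 2).natAbs.primeFactors with 5 ≤ p,
          (W₀.c₄ ^ 3 - W₀.c₆ ^ 2).natAbs.factorization p) ≤
        ∏ p ∈ ((W₀.baseChange ℚ).conductorNorm ℤ).primeFactors with
            ¬ p ^ 2 ∣ (W₀.baseChange ℚ).conductorNorm ℤ,
          ((W₀.baseChange ℚ).minimalDiscriminantNorm ℤ).factorization p) →
    (∃ θ : ℝ, 0 < θ ∧ ∀ ε : ℝ, 0 < ε → ∀ K : ℝ, ∃ C : ℝ, ∀ x y : ℤ, x ^ 3 - y ^ 2 ≠ 0 →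
      (1728 : ℤ) ∣ x ^ 3 - y ^ 2 →
      (¬ ((2 : ℤ) ^ 8 ∣ x ∧ (2 : ℤ) ^ 11 ∣ y ∧ (2 : ℤ) ^ 12 * 1728 ∣ x ^ 3 - y ^ 2) ∧
        ¬ ((3 : ℤ) ^ 4 ∣ x ∧ (3 : ℤ) ^ 9 ∣ y ∧ (3 : ℤ) ^ 12 * 1728 ∣ x ^ 3 - y ^ 2)) → True →
      (∀ p : ℕ, p.Prime → 5 ≤ p → (p : ℤ) ∣ x → ¬ (p : ℤ) ∣ x ^ 3 - y ^ 2) →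
      ((∏ p ∈ (x ^ 3 - y ^ 2).natAbs.primeFactors with 5 ≤ p, (x ^ 3 - y ^ 2).natAbs.factorization p : ℕ) : ℝ)
        ≤ K * ((∏ p ∈ (x ^ 3 - y ^ 2).natAbs.primeFactors with 5 ≤ p, p : ℕ) : ℝ) ^ θ →
      ((max |x ^ 3 - y ^ 2| (|x| ^ 3) : ℤ) : ℝ) ≤
        C * (((∏ p ∈ (x ^ 3 - y ^ 2).natAbs.primeFactors with 5 ≤ p, p : ℕ) : ℝ) *
          ((∏ p ∈ (x ^ 3 - y ^ 2).natAbs.primeFactors with 5 ≤ p,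
            (x ^ 3 - y ^ 2).natAbs.factorization p : ℕ) : ℝ)) ^ (6 + ε)) →
    ThinWeightedSzpiro := by
  intro hloc hwt hhall
  obtain ⟨θ, hθ, hH⟩ := hhall
  unfold ThinWeightedSzpiro
  refine ⟨θ, hθ, fun ε hε K => ?_⟩
  obtain ⟨C, hC⟩ := hH ε hε (max K 0 * (768 : ℝ) ^ θ)
  refine ⟨max C 0, fun W₀ hE hmin hss hthin => ?_⟩
  haveI := hE
  obtain ⟨hz0, h1728, hprim, hcop⟩ := hloc W₀ hE hmin hss
  obtain ⟨hRN, hN768, hVT⟩ := hwt W₀ hE hmin hss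
  -- `N > 0`, `N ≤ 768 R`
  have hNpos : 0 < (W₀.baseChange ℚ).conductorNorm ℤ :=
    WeierstrassCurve.conductorNorm_pos_holds (W₀.baseChange ℚ)
  have hNle := Nat.le_of_dvd
    (Nat.mul_pos (by norm_num) (stubTransfer_prod_filter_five_le_pos _)) hN768
  -- the normal form at `(x, y) = (c₄, c₆)` with constant `max K 0 · 768^θ`
  have key := hC W₀.c₄ W₀.c₆ hz0 h1728 hprim trivial hcop
    (stubTransfer_thin_aux hθ hNpos hNle hVT hthin)
  exact stubTransfer_chain_aux hε key (Int.cast_le.mpr (stubTransfer_max_abs_le_aux W₀))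
    (Nat.le_of_dvd hNpos hRN) hVT

end Summit.ABC.ABC.Theorems.ThinWeightedSzpiro
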